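import Mathlib

/-!
# Route OverlapGapAlgebra, crux `SolvableImpliesStableSection` (stmt-PneNP-2463), line `Sketch`:
# re-randomising one coordinate of a uniform product space

`stub_rerandomize` (stub 4 of the block "one round of local repair"): on the uniform product space
`ι → C`, if a statistic `R` does not depend on coordinate `i`, then
`#C · Σ_Φ h (Φ i) (R Φ) = Σ_Φ Σ_c h c (R Φ)`, i.e. coordinate `i` may be re-sampled independently
of `R`.  Proof: the map `(Φ, c) ↦ (update Φ i c, Φ i)` is an involution of `(ι → C) × C` carrying
`h (Φ i) (R Φ)` to `h c (R Φ)` (by the invariance of `R`), so the two sums over `(ι → C) × C` agree.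
-/

set_option linter.dupNamespace false -- `Summit.PneNP.PneNP.…`: summit = sub-problem (D-0017)

namespace Summit.PneNP.PneNP.Cruxes.SolvableImpliesStableSection.Sketch

open Finset
open scoped Classical

/-- **Re-randomising one coordinate.** On the uniform product space `ι → C`, if `R` does not
depend on coordinate `i` (`hR`), then averaging `h (Φ i) (R Φ)` over `Φ` is the same as averaging
`h c (R Φ)` over `Φ` and an independent uniform `c`:
`#C · Σ_Φ h (Φ i) (R Φ) = Σ_Φ Σ_c h c (R Φ)`.  The involution `(Φ, c) ↦ (update Φ i c, Φ i)` of
`(ι → C) × C` matches the two double sums term by term. -/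
theorem stub_rerandomize {ι C β : Type*} [Fintype ι] [DecidableEq ι] [Fintype C] (i : ι)
    (R : (ι → C) → β) (hR : ∀ (Φ : ι → C) (c : C), R (Function.update Φ i c) = R Φ)
    (h : C → β → ℝ) :
    (Fintype.card C : ℝ) * ∑ Φ : ι → C, h (Φ i) (R Φ) = ∑ Φ : ι → C, ∑ c : C, h c (R Φ) := by
  -- the swap `(Φ, c) ↦ (Φ with coordinate `i` set to `c`, old value of `Φ i`)` is an involution
  have hσ : Function.Involutive
      (fun p : (ι → C) × C => (Function.update p.1 i p.2, p.1 i)) := by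
    rintro ⟨Φ, c⟩
    simp
  calc (Fintype.card C : ℝ) * ∑ Φ : ι → C, h (Φ i) (R Φ)
      = ∑ Φ : ι → C, ∑ _c : C, h (Φ i) (R Φ) := by
        simp [mul_sum]
    _ = ∑ p : (ι → C) × C, h (p.1 i) (R p.1) :=
        (Fintype.sum_prod_type' fun (Φ : ι → C) (_c : C) => h (Φ i) (R Φ)).symm
    _ = ∑ p : (ι → C) × C, h p.2 (R p.1) := by
        refine Fintype.sum_bijective _ hσ.bijective _ _ fun p => ?_
        simp only [hR]
    _ = ∑ Φ : ι → C, ∑ c : C, h c (R Φ) := Fintype.sum_prod_type' fun (Φ : ι → C) (c : C) => h c (R Φ)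

end Summit.PneNP.PneNP.Cruxes.SolvableImpliesStableSection.Sketch
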